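import Summits.AtomisticToContinuum.Crystallization.Theorems.FreeSplittingCertificatesStrictSplittingRuleTorusModel442CovA

/-!
# Torus model 4×4×2: the covariance CHECK for parity B

Route `FreeSplittingCertificates`, crux `StrictSplittingRule` (stmt-AtomisticToContinuum-12560); unit b2b-freesplit-B (block 2b,
PART B, gen 1).  VALUE = theorem about a FINITE model — NOT summit progress.  See `…TorusModel442CovA.lean` (machinery, parity A)
and `…TorusModel442AllSites.lean` (the transport theorem).  COMPUTATIONAL (`native_decide`). [folklore]
-/

namespace Summit.AtomisticToContinuum.Crystallization.Theorems.StrictSplittingRuleTorusLMI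

/-- **Covariance check, parity B.**  COMPUTATIONAL (`native_decide`). -/
theorem covB_check : ∀ g ∈ evenShifts,
    siteTermLists (tadd siteB g) = (siteTermLists siteB).map fun ts => ts.map (shiftTerm (shiftIdx g)) := by
  native_decide

end Summit.AtomisticToContinuum.Crystallization.Theorems.StrictSplittingRuleTorusLMI
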